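import Summits.QuantumFields.YangMills.Theorems.AlphaInputsT3ACv3SmoothLiftCandidateDefect
import Summits.QuantumFields.YangMills.Theorems.AlphaInputsT3ACv3FLContractionCore
import Summits.QuantumFields.YangMills.Theorems.AlphaInputsT3ACv3GlueLedger
import HarnessLib

/-!
# `AlphaInputsT3ACv3FramedCandidate` — non-abelian (FL), Newton row R9′ (the glued START), letter (A): **THE FRAMED CANDIDATE** — for a coarse frame
# `g : T^{(k)} → SU(n)` in which the datum reads `V^{g}(c) = exp(A c)` with `A` sup-small, the finest field `U^{(g)} := (cand k A)^{ĝ⁻¹}`, `ĝ := g ∘ iterBlockOf k`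
# (pull-back by the BLOCK-CONSTANT extension of the inverse frame), has (i) the DILUTE plaquettes of `cand k A` (gauge invariance), (ii) the SAME multiplicative `k`-fold
# defect against `V` as `cand k A` has against `exp A` — `‖Ū^{(k)}(c)·V(c)* − 1‖ = ‖c̄and^{(k)}(c)·e^{−A c} − 1‖ ≤ (K₁+3)·M²`, `k`-free, every odd `L > 1` —, (iii) bond variables
# within `2C_S·M/L^k` of `1` IN THE FRAME, (iv) covariance under coarse gauge changes; and the frame LOGARITHM `A := 𝟙_E·mlog V^{g}` (zero extension off the flattened bond set
# `E`) exists with `‖A‖ ≤ 2r` whenever `‖V^{g}(c) − 1‖ ≤ r ≤ 1/4` on `E` — cell `ym3-torus`, width seat `ym-ust-19936-w5` (g2); composed BY NAME from ★w2 g2's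
# `…SmoothLiftCandidate{,AllL,Defect}` (`cand`, `dataSU`, `norm_iter_cand_mul_star_data_sub_one_le_allL`), ★w1's `FLContraction.iter_gaugeAct_blockConst` and ★w4's
# `GlueLedger.glueData_of_near`

WHY (OWNER RULING g24-№4 «(FL)_non-ab ⇐ hLift ⇐ Newton on the (LL) engine»; ★w1 LEAD memo `NONABELIAN-FL-NEWTON-w1-g0.md` v2.1 §6 (R9′) «GLUED START: `U⁰ :=` POU-glue of the stencil
candidates (cell by cell, … in the common frame)»; ★w4 `NEWTON-FL-FRAMES-w4-g0.md` §4 «blockwise comb-axial frames of V itself … candidate on block y: `U₀ := frame-rotate⁻¹ e^{liftS(A^{(y)})}`»).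
The datum `V` of the `hLift` binder (p590363 `…v3InnerLiftFromRegionalThm1`) has small PLAQUETTES on `Ω`, not small bond variables: there is no global gauge with `V ≈ 1` (torus∕region
holonomies are `O(1)`).  ★w2 g2's START `cand k A` (`…SmoothLiftCandidate`) lives in ONE flat frame (`V = exp A`, `‖A‖ ≤ M`).  The glued START of R9′ is assembled from the candidates
of the LOCAL frames `g_y` (★w1's regional comb-axial gauges `…v3RegionAxialGauge.dist1_gaugeActT_axialT_le_of_box`, one per stencil), each pulled back to the original gauge.  THIS FILE is
that pull-back, as kernel-checked bookkeeping with every constant inherited verbatim from the flat frame: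
* §1 `framed k g U := U^{ĝ⁻¹}` (one def; `ĝ = g ∘ iterBlockOf k` block-constant), `framed_apply`, `gaugeAct_blockExt_framed` (`(U^{ĝ⁻¹})^{ĝ} = U`), ★ `dist1_plaqHol_framed` (plaquettes
  unchanged), ★ `iter_framed`∕`iter_framed_apply` (`k`-fold averages of ANY covariant family: `avg^k(U^{ĝ⁻¹}) = (avg^k U)^{g⁻¹}`, ★w1's `iter_gaugeAct_blockConst`), `framed_frameChange`
  (covariance: changing the coarse gauge of `V` by `u` and the frame to `g·u⁻¹` moves the framed field by the block-constant `û`), `gaugeAct_frameChange` (the frame relation is kept).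
* §2 (`SU(n)`) ★★ `coe_iter_framed_mul_star_eq` — THE DEFECT IDENTITY `Ū^{ĝ⁻¹,(k)}(c)·V(c)* = g(c₋)⁻¹·[Ū^{(k)}(c)·(V^{g}(c))*]·g(c₋)` — and `norm_iter_framed_mul_star_sub_one_eq` (the
  multiplicative defect of the framed field against `V` EQUALS that of `U` against `V^{g}`: unitary conjugation).
* §3 ★★ `norm_iter_framedCand_mul_star_sub_one_le_allL`: for `U = cand k A` and a coarse bond `c` at which the frame relation `V^{g}(c) = exp(A c)` holds, `‖Ū^{(k)}(c)·V(c)* − 1‖ ≤ (K₁+3)M²`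
  (★w2 g2's `norm_iter_cand_mul_star_data_sub_one_le_allL` through §2); `dist1_plaqHol_framedCand_le` ((ii) of S-CAND through §1); `norm_coe_frame_framedCand_sub_one_le` (in the frame the
  bond variables are those of `cand`).
* §4 THE FRAME LOGARITHM: `exists_lieSU_log_of_norm_sub_one_le` (one matrix: `‖W − 1‖ ≤ r ≤ 1/4`, `|n|r < π` ⟹ `W = exp X`, `X ∈ 𝔰𝔲(n)`, `‖X‖ ≤ 2r`; ★w4's `glueData_of_near` at `U_b = 1`),
  ★★ `exists_frameLog` (fieldwise, with the ZERO EXTENSION off the flattened set `E`: `A c ∈ 𝔰𝔲(n)`, `‖A c‖ ≤ 2r` everywhere, `exp(A c) = V^{g}(c)` on `E`, `A c = 0` off `E`).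
* §5 ★★★ `exists_framedCandidate_allL`: frame `g` with `‖V^{g}(c) − 1‖ ≤ r` on `E` and the `k`-free smallness rows of S-CAND at `M := 2r` ⟹ a finest `SU(n)` field with ALL plaquettes within
  `(4·18^d·M + 16(C_S M)²)/(L^k)²`, multiplicative `k`-fold defect `≤ (K₁+3)M²` against `V` on EVERY `c ∈ E`, and bond variables within `2C_S M/L^k` of `1` in the frame `ĝ`.
WHAT IS NOT HERE.  The frames themselves (★w1 p586049), the comparison of two framed candidates on an overlap (transition letter (C)) and the blend (letter (B)) are separate files;
locality is not needed at this stage because the zero-extended logarithm is a GLOBAL sup-small datum (alpha-2 g5's device, DESIGN NOTE 01:35:54Z (1)).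
HONEST FRAMING.  Group bookkeeping over landed kernel lemmas; count-neutral helper toward R3 2′ (items 19936∕19935, `--supports stmt-QuantumFields-19936`); `hLift`∕(FL), the stub
`stub_laneRecordsV3Chi`, the crux `HistoryTailL` and the gap are NOT claimed; registry untouched; YM₃ on T³ is rung R3 of the YM ladder, not the Clay problem.

References: T. Bałaban, Commun. Math. Phys. 98 (1985) 17–51 [Balaban1985Averaging] ((8)–(9) p.18, (11)–(13) p.19, (19)–(20) p.21, pp.24–25); Commun. Math. Phys. 102 (1985) 277–309
[Balaban1985Variational] ((4) p.278, Thm 1 (8) p.279, (11)–(13) pp.279–280, (15) p.280).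
-/

set_option autoImplicit false

noncomputable section

open scoped Matrix.Norms.L2Operator
open NormedSpace

namespace Summit.QuantumFields.YangMills.Theorems.FramedCandidate

open Literature.MathematicalPhysics.QuantumFieldTheory.Balaban1983to89
open T4Continuum AveragingRT BlockAveraging ExpMeanLog BlockAveragingEMLLinearised
open Literature.MathematicalPhysics.QuantumFieldTheory.Balaban1983to89.T4AdjointCovarianceUnitary (lieSU expSU coe_expSU mem_lieSU_iff)
open Literature.MathematicalPhysics.QuantumFieldTheory.Balaban1983to89.B5Eq118OneStroke (iterBlockOf)
open Literature.MathematicalPhysics.QuantumFieldTheory.Balaban1983to89.MatrixLog (mlog)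
open Summit.QuantumFields.YangMills.Theorems.LinearLiftMatrix (CS CS_nonneg)
open Summit.QuantumFields.YangMills.Theorems.SmoothLiftCandidate (cand coe_cand dataSU coe_dataSU norm_coe_cand_sub_one_le dist1_plaqHol_cand_le
  norm_iter_cand_mul_star_data_sub_one_le_allL)
open Summit.QuantumFields.YangMills.Theorems.FLContraction (iter_gaugeAct_blockConst dist1_plaqHol_gaugeAct)
open Summit.QuantumFields.YangMills.Theorems.GlueLedger (glueData_of_near)

/-! ## §1 The pull-back by a block-constant frame (any gauge group) -/

section AnyGroup

variable {P : Params} {G : Type*} [GaugeGroup G]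

/-- **THE FRAMED FIELD** `U^{ĝ⁻¹}`: the finest field `U` pulled back by the inverse of the BLOCK-CONSTANT extension `ĝ = g ∘ iterBlockOf k` of a coarse frame `g : T^{(k)} → G`
(`U^{ĝ⁻¹}_b = g(β(b₋))⁻¹·U_b·g(β(b₊))`, `β = iterBlockOf k`). [cite: Balaban1985Variational, (4) p.278; Balaban1985Averaging, (8) p.18] -/
def framed (k : ℕ) (g : GaugeTransf P k G) (U : GaugeField P 0 G) : GaugeField P 0 G :=
  GaugeField.gaugeAct (fun x : Site P 0 => (g (iterBlockOf k x))⁻¹) U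

variable (k : ℕ)

/-- `U^{ĝ⁻¹}_b = g(β(b₋))⁻¹ · U_b · g(β(b₊))`. [cite: Balaban1985Averaging, (8) p.18] -/
theorem framed_apply (g : GaugeTransf P k G) (U : GaugeField P 0 G) (b : PBond P 0) :
    framed k g U b = (g (iterBlockOf k b.src))⁻¹ * U b * g (iterBlockOf k b.tgt) := by
  simp [framed, GaugeField.gaugeAct]

/-- Framing is undone by the block-constant frame: `(U^{ĝ⁻¹})^{ĝ} = U`. [cite: Balaban1985Averaging, (8) p.18] -/
theorem gaugeAct_blockExt_framed (g : GaugeTransf P k G) (U : GaugeField P 0 G) :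
    GaugeField.gaugeAct (fun x : Site P 0 => g (iterBlockOf k x)) (framed k g U) = U := by
  funext b
  simp only [framed, GaugeField.gaugeAct]
  group

/-- Conversely `(U^{ĝ})` framed by `g` is `U`. [cite: Balaban1985Averaging, (8) p.18] -/
theorem framed_gaugeAct_blockExt (g : GaugeTransf P k G) (U : GaugeField P 0 G) :
    framed k g (GaugeField.gaugeAct (fun x : Site P 0 => g (iterBlockOf k x)) U) = U := by
  funext b
  simp only [framed, GaugeField.gaugeAct]
  group

/-- ★ **PLAQUETTES ARE UNCHANGED BY FRAMING** (gauge invariance of `|U(∂p) − 1|`). [cite: Balaban1985Averaging, (9)+(12) p.19] -/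
theorem dist1_plaqHol_framed (g : GaugeTransf P k G) (U : GaugeField P 0 G) (q : Plaq P 0) :
    GaugeGroup.dist1 (GaugeField.plaqHol (framed k g U) q) = GaugeGroup.dist1 (GaugeField.plaqHol U q) :=
  dist1_plaqHol_gaugeAct _ U q

/-- ★ **`k`-FOLD AVERAGES OF THE FRAMED FIELD**: `avg^k(U^{ĝ⁻¹}) = (avg^k U)^{g⁻¹}` for every family of covariant one-step averagings (`k ≤ m + K`) — ★w1's exact covariance
under block-constant gauge transformations. [cite: Balaban1985Averaging, (11)–(13) p.19; Balaban1985Variational, (4) p.278] -/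
theorem iter_framed (av : ∀ j, Averaging P j G) (hk : k ≤ P.m + P.K) (g : GaugeTransf P k G) (U : GaugeField P 0 G) :
    Averaging.iter av k (framed k g U) = GaugeField.gaugeAct (fun y : Site P k => (g y)⁻¹) (Averaging.iter av k U) :=
  iter_gaugeAct_blockConst av hk (fun y : Site P k => (g y)⁻¹) U

/-- Bondwise: `avg^k(U^{ĝ⁻¹})(c) = g(c₋)⁻¹ · avg^k(U)(c) · g(c₊)`. [cite: Balaban1985Averaging, (11)–(13) p.19] -/
theorem iter_framed_apply (av : ∀ j, Averaging P j G) (hk : k ≤ P.m + P.K) (g : GaugeTransf P k G) (U : GaugeField P 0 G) (c : PBond P k) :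
    Averaging.iter av k (framed k g U) c = (g c.src)⁻¹ * Averaging.iter av k U c * g c.tgt := by
  rw [iter_framed k av hk g U]
  simp [GaugeField.gaugeAct]

/-- The group identity behind the defect identity: `(g₋⁻¹ Ū g₊)·V⁻¹ = g₋⁻¹ · (Ū · (g₋ V g₊⁻¹)⁻¹) · g₋`. [folklore] -/
theorem framed_defect_group (g₁ g₂ Ubar V : G) : g₁⁻¹ * Ubar * g₂ * V⁻¹ = g₁⁻¹ * (Ubar * (g₁ * V * g₂⁻¹)⁻¹) * g₁ := by
  group

/-- **COVARIANCE OF FRAMING UNDER A COARSE GAUGE CHANGE**: with the frame `g·u⁻¹` (which flattens `V^{u}` exactly as `g` flattens `V`, `gaugeAct_frameChange`) the framed field is the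
old one moved by the block-constant `û = u ∘ iterBlockOf k`. [cite: Balaban1985Averaging, (8), (11)–(13) pp.18–19] -/
theorem framed_frameChange (g u : GaugeTransf P k G) (U : GaugeField P 0 G) :
    framed k (fun y => g y * (u y)⁻¹) U = GaugeField.gaugeAct (fun x : Site P 0 => u (iterBlockOf k x)) (framed k g U) := by
  funext b
  simp only [framed, GaugeField.gaugeAct]
  group

/-- The frame relation is kept under a coarse gauge change: `(V^{u})^{g u⁻¹} = V^{g}`. [cite: Balaban1985Averaging, (8) p.18] -/
theorem gaugeAct_frameChange {j : ℕ} (g u : GaugeTransf P j G) (V : GaugeField P j G) :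
    GaugeField.gaugeAct (fun y => g y * (u y)⁻¹) (GaugeField.gaugeAct u V) = GaugeField.gaugeAct g V := by
  funext c
  simp only [GaugeField.gaugeAct]
  group

end AnyGroup

/-! ## §2 The defect identity in `SU(n)` -/

section SU

variable {P : Params} {n : Type*} [Fintype n] [DecidableEq n] [Nonempty n]
variable (k : ℕ)

/-- ★★ **THE DEFECT IDENTITY**: `Ū^{ĝ⁻¹,(k)}(c) · V(c)* = g(c₋)* · [Ū^{(k)}(c) · (V^{g}(c))*] · g(c₋)` on matrices, for every covariant family of averagings (`k ≤ m + K`).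
[cite: Balaban1985Averaging, (11)–(13) p.19; Balaban1985Variational, (4) p.278, (11) p.279] -/
theorem coe_iter_framed_mul_star_eq (av : ∀ j, Averaging P j (Matrix.specialUnitaryGroup n ℂ)) (hk : k ≤ P.m + P.K) (g : GaugeTransf P k (Matrix.specialUnitaryGroup n ℂ))
    (U : GaugeField P 0 (Matrix.specialUnitaryGroup n ℂ)) (V : GaugeField P k (Matrix.specialUnitaryGroup n ℂ)) (c : PBond P k) :
    ((Averaging.iter av k (framed k g U) c : Matrix.specialUnitaryGroup n ℂ) : Matrix n n ℂ) * star ((V c : Matrix.specialUnitaryGroup n ℂ) : Matrix n n ℂ) =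
      star ((g c.src : Matrix.specialUnitaryGroup n ℂ) : Matrix n n ℂ) *
        (((Averaging.iter av k U c : Matrix.specialUnitaryGroup n ℂ) : Matrix n n ℂ) * star ((GaugeField.gaugeAct g V c : Matrix.specialUnitaryGroup n ℂ) : Matrix n n ℂ)) *
        ((g c.src : Matrix.specialUnitaryGroup n ℂ) : Matrix n n ℂ) := by
  have hgrp : Averaging.iter av k (framed k g U) c * (V c)⁻¹ = (g c.src)⁻¹ * (Averaging.iter av k U c * (GaugeField.gaugeAct g V c)⁻¹) * g c.src := by
    rw [iter_framed_apply k av hk g U c]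
    exact framed_defect_group (g c.src) (g c.tgt) (Averaging.iter av k U c) (V c)
  have h := congrArg (fun W : Matrix.specialUnitaryGroup n ℂ => (W : Matrix n n ℂ)) hgrp
  have hinv : ∀ W : Matrix.specialUnitaryGroup n ℂ, ((W⁻¹ : Matrix.specialUnitaryGroup n ℂ) : Matrix n n ℂ) = star (W : Matrix n n ℂ) := fun _ => rfl
  simp only [Submonoid.coe_mul, hinv] at h
  exact h

omit [Nonempty n] in
/-- `‖u*·X·u − 1‖ = ‖X − 1‖` for `u ∈ SU(n)` (operator norm). [folklore] -/
theorem norm_star_mul_mul_sub_one_eq (u : Matrix.specialUnitaryGroup n ℂ) (X : Matrix n n ℂ) :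
    ‖star (u : Matrix n n ℂ) * X * (u : Matrix n n ℂ) - 1‖ = ‖X - 1‖ := by
  have e : star (u : Matrix n n ℂ) * X * (u : Matrix n n ℂ) - 1 = star (u : Matrix n n ℂ) * (X - 1) * (u : Matrix n n ℂ) := by
    have hu : star (u : Matrix n n ℂ) * (u : Matrix n n ℂ) = 1 := Matrix.mem_unitaryGroup_iff'.mp (Matrix.specialUnitaryGroup_le_unitaryGroup u.2)
    noncomm_ring
    rw [hu]
  rw [e, CStarRing.norm_mul_mem_unitary _ u.2.1, CStarRing.norm_mem_unitary_mul _ (Unitary.star_mem u.2.1)]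

/-- ★★ **THE MULTIPLICATIVE DEFECT OF THE FRAMED FIELD AGAINST `V` EQUALS THAT OF `U` AGAINST `V^{g}`.** [cite: Balaban1985Variational, (4) p.278, (11)–(13) pp.279–280] -/
theorem norm_iter_framed_mul_star_sub_one_eq (av : ∀ j, Averaging P j (Matrix.specialUnitaryGroup n ℂ)) (hk : k ≤ P.m + P.K) (g : GaugeTransf P k (Matrix.specialUnitaryGroup n ℂ))
    (U : GaugeField P 0 (Matrix.specialUnitaryGroup n ℂ)) (V : GaugeField P k (Matrix.specialUnitaryGroup n ℂ)) (c : PBond P k) :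
    ‖((Averaging.iter av k (framed k g U) c : Matrix.specialUnitaryGroup n ℂ) : Matrix n n ℂ) * star ((V c : Matrix.specialUnitaryGroup n ℂ) : Matrix n n ℂ) - 1‖ =
      ‖((Averaging.iter av k U c : Matrix.specialUnitaryGroup n ℂ) : Matrix n n ℂ) * star ((GaugeField.gaugeAct g V c : Matrix.specialUnitaryGroup n ℂ) : Matrix n n ℂ) - 1‖ := by
  rw [coe_iter_framed_mul_star_eq k av hk g U V c, norm_star_mul_mul_sub_one_eq]

/-- In the frame, the bond variables of the framed field are those of `U`: `‖(U^{ĝ⁻¹})^{ĝ}_b − 1‖ = ‖U_b − 1‖`. [cite: Balaban1985Averaging, (8) p.18] -/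
theorem norm_coe_frame_framed_sub_one_eq (g : GaugeTransf P k (Matrix.specialUnitaryGroup n ℂ)) (U : GaugeField P 0 (Matrix.specialUnitaryGroup n ℂ)) (b : PBond P 0) :
    ‖((GaugeField.gaugeAct (fun x : Site P 0 => g (iterBlockOf k x)) (framed k g U) b : Matrix.specialUnitaryGroup n ℂ) : Matrix n n ℂ) - 1‖ =
      ‖((U b : Matrix.specialUnitaryGroup n ℂ) : Matrix n n ℂ) - 1‖ := by
  rw [gaugeAct_blockExt_framed]

/-- Inside a block (both ends of `b` in the same `k`-block) framing is a CONSTANT conjugation: `‖U^{ĝ⁻¹}_b − 1‖ = ‖U_b − 1‖`. [cite: Balaban1985Averaging, (8) p.18, (19) p.21] -/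
theorem norm_coe_framed_sub_one_eq_of_sameBlock (g : GaugeTransf P k (Matrix.specialUnitaryGroup n ℂ)) (U : GaugeField P 0 (Matrix.specialUnitaryGroup n ℂ)) (b : PBond P 0)
    (hb : iterBlockOf k b.tgt = iterBlockOf k b.src) :
    ‖((framed k g U b : Matrix.specialUnitaryGroup n ℂ) : Matrix n n ℂ) - 1‖ = ‖((U b : Matrix.specialUnitaryGroup n ℂ) : Matrix n n ℂ) - 1‖ := by
  have e : framed k g U b = (g (iterBlockOf k b.src))⁻¹ * U b * g (iterBlockOf k b.src) := by rw [framed_apply, hb]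
  have hinv : (((g (iterBlockOf k b.src))⁻¹ : Matrix.specialUnitaryGroup n ℂ) : Matrix n n ℂ) = star ((g (iterBlockOf k b.src) : Matrix.specialUnitaryGroup n ℂ) : Matrix n n ℂ) := rfl
  rw [e, Submonoid.coe_mul, Submonoid.coe_mul, hinv, norm_star_mul_mul_sub_one_eq]

end SU

/-! ## §3 The framed candidate -/

section Cand

variable {P : Params} {n : Type*} [Fintype n] [DecidableEq n] [Nonempty n]
variable (k : ℕ) (hk : k ≤ P.m + P.K)

include hk in
/-- ★★ **THE FRAMED CANDIDATE'S MULTIPLICATIVE DEFECT AGAINST THE DATUM, `k`-FREE AT EVERY `L`**: for the frame relation `V^{g}(c) = exp(A c)` at the coarse bond `c` and `𝔰𝔲(n)`-valued `A`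
with `‖A‖ ≤ M` small (the rows of ★w2 g2's `…SmoothLiftCandidateDefect`), `‖Ū^{(k)}(c)·V(c)* − 1‖ ≤ (K₁+3)·M²` for `U := (cand k A)^{ĝ⁻¹}`.
[cite: Balaban1985Averaging, Prop. 4 (134)–(135) p.38; Balaban1985Variational, (4) p.278, (11)–(13) pp.279–280] -/
theorem norm_iter_framedCand_mul_star_sub_one_le_allL (g : GaugeTransf P k (Matrix.specialUnitaryGroup n ℂ)) (V : GaugeField P k (Matrix.specialUnitaryGroup n ℂ))
    (A : PBond P k → Matrix n n ℂ) (hA : ∀ c, A c ∈ lieSU n) {M : ℝ} (hM : ∀ c, ‖A c‖ ≤ M) (hM1 : CS P * M ≤ 1) (hM1' : M ≤ 1)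
    (hm : (((P.d : ℝ) + 1) * ((18 : ℝ) ^ P.d * (2 + ((P.d : ℝ) + 1) * (18 : ℝ) ^ P.d)) * (324 * (((P.d + 2) * P.L : ℕ) : ℝ) ^ 2) / ((P.L : ℝ) * ((P.L : ℝ) - 1))) * (2 * (((P.d : ℝ) + 1) * (CS P * M))) ≤ 1)
    (h32 : 32 * (((P.d + 2) * P.L : ℕ) : ℝ) * (2 * (((P.d : ℝ) + 1) * (CS P * M))) ≤ 1)
    (hN : 4 * (((P.d + 2) * P.L : ℕ) : ℝ) * (2 * (((P.d : ℝ) + 1) * (CS P * M))) < deltaSU n) (c : PBond P k)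
    (hc : GaugeField.gaugeAct g V c = dataSU k A hA c) :
    ‖((Averaging.iter (fun i => blockAvg (P := P) (j := i) (expMeanLogSU (n := n))) k (framed k g (cand k A hA)) c : Matrix.specialUnitaryGroup n ℂ) : Matrix n n ℂ) *
          star ((V c : Matrix.specialUnitaryGroup n ℂ) : Matrix n n ℂ) - 1‖ ≤
      (((((P.d : ℝ) + 1) * ((18 : ℝ) ^ P.d * (2 + ((P.d : ℝ) + 1) * (18 : ℝ) ^ P.d)) * (324 * (((P.d + 2) * P.L : ℕ) : ℝ) ^ 2) / ((P.L : ℝ) * ((P.L : ℝ) - 1))) *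
            (2 * (((P.d : ℝ) + 1) * CS P)) ^ 2 + ((P.d : ℝ) + 1) * CS P ^ 2) + 3) * M ^ 2 := by
  rw [norm_iter_framed_mul_star_sub_one_eq k _ hk g (cand k A hA) V c, hc]
  exact norm_iter_cand_mul_star_data_sub_one_le_allL k hk A hA hM hM1 hM1' hm h32 hN c

include hk in
/-- **(ii) THE FRAMED CANDIDATE HAS THE DILUTE PLAQUETTES OF `cand`**: every finest plaquette within `(4·18^d·M + 16(C_S M)²)/(L^k)²` of `1` (`4·C_S·M ≤ 1`).
[cite: Balaban1985Variational, Thm 1 (8) p.279; Balaban1985Averaging, (9)+(12) p.19] -/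
theorem dist1_plaqHol_framedCand_le (g : GaugeTransf P k (Matrix.specialUnitaryGroup n ℂ)) (A : PBond P k → Matrix n n ℂ) (hA : ∀ c, A c ∈ lieSU n) {M : ℝ}
    (hM : ∀ c, ‖A c‖ ≤ M) (hM4 : 4 * (CS P * M) ≤ 1) (q : Plaq P 0) :
    GaugeGroup.dist1 (GaugeField.plaqHol (framed k g (cand k A hA)) q) ≤ 4 * (18 : ℝ) ^ P.d * M / ((P.L : ℝ) ^ k) ^ 2 + 16 * (CS P * M / (P.L : ℝ) ^ k) ^ 2 := by
  rw [dist1_plaqHol_framed]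
  exact dist1_plaqHol_cand_le k hk A hA hM hM4 q

include hk in
/-- **(iii) IN THE FRAME, THE FRAMED CANDIDATE'S BOND VARIABLES ARE WITHIN `2C_S·M/L^k` OF `1`** (`C_S·M ≤ 1`). [cite: Balaban1985Variational, Thm 1 (8) p.279] -/
theorem norm_coe_frame_framedCand_sub_one_le (g : GaugeTransf P k (Matrix.specialUnitaryGroup n ℂ)) (A : PBond P k → Matrix n n ℂ) (hA : ∀ c, A c ∈ lieSU n) {M : ℝ}
    (hM : ∀ c, ‖A c‖ ≤ M) (hM1 : CS P * M ≤ 1) (b : PBond P 0) :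
    ‖((GaugeField.gaugeAct (fun x : Site P 0 => g (iterBlockOf k x)) (framed k g (cand k A hA)) b : Matrix.specialUnitaryGroup n ℂ) : Matrix n n ℂ) - 1‖ ≤
      2 * (CS P * M / (P.L : ℝ) ^ k) := by
  rw [norm_coe_frame_framed_sub_one_eq]
  exact (norm_coe_cand_sub_one_le k hk A hA hM hM1 b).1

end Cand

/-! ## §4 The frame logarithm (zero extension off the flattened set) -/

section Log

variable {P : Params} {n : Type*} [Fintype n] [DecidableEq n] [Nonempty n]

/-- **ONE MATRIX**: `W ∈ SU(n)` with `‖W − 1‖ ≤ r ≤ 1/4` and `|n|·r < π` is `exp X` with `X = mlog W ∈ 𝔰𝔲(n)`, `‖X‖ ≤ 2r` (★w4's `glueData_of_near` at the reference `1`).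
[cite: Balaban1985Variational, (15) p.280; Balaban1985Averaging, (20) p.21] -/
theorem exists_lieSU_log_of_norm_sub_one_le (W : Matrix.specialUnitaryGroup n ℂ) {r : ℝ} (hr : ‖(W : Matrix n n ℂ) - 1‖ ≤ r) (hr4 : r ≤ 1 / 4)
    (hπ : (Fintype.card n : ℝ) * r < Real.pi) :
    ∃ X : Matrix n n ℂ, ∃ hX : X ∈ lieSU n, ‖X‖ ≤ 2 * r ∧ expSU ⟨X, hX⟩ = W := by
  have e1 : (W : Matrix n n ℂ) * star (((1 : Matrix.specialUnitaryGroup n ℂ) : Matrix.specialUnitaryGroup n ℂ) : Matrix n n ℂ) = (W : Matrix n n ℂ) := by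
    rw [OneMemClass.coe_one, star_one, mul_one]
  have h1 : ‖(W : Matrix n n ℂ) * star (((1 : Matrix.specialUnitaryGroup n ℂ) : Matrix.specialUnitaryGroup n ℂ) : Matrix n n ℂ) - 1‖ ≤ r := by
    rw [e1]; exact hr
  obtain ⟨hs, ht, hn, he⟩ := glueData_of_near W 1 h1 hr4 hπ
  rw [e1] at hs ht hn he
  rw [OneMemClass.coe_one, mul_one] at he
  refine ⟨mlog (W : Matrix n n ℂ), mem_lieSU_iff.mpr ⟨hs, ht⟩, hn, ?_⟩
  apply Subtype.ext
  rw [coe_expSU]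
  exact he

open Classical in
/-- ★★ **THE FRAME LOGARITHM WITH ZERO EXTENSION**: if the framed datum is within `r ≤ 1/4` of `1` on a set `E` of coarse bonds (`|n|·r < π`), there is an `𝔰𝔲(n)`-valued `A` on ALL
coarse bonds with `‖A c‖ ≤ 2r` everywhere, `exp(A c) = V^{g}(c)` on `E`, and `A c = 0` off `E` — a GLOBAL sup-small datum for ★w2 g2's `cand` (no locality needed downstream).
[cite: Balaban1985Averaging, (20) p.21, pp.24–25; Balaban1985Variational, (15), (18) p.280] -/
theorem exists_frameLog {k : ℕ} (g : GaugeTransf P k (Matrix.specialUnitaryGroup n ℂ)) (V : GaugeField P k (Matrix.specialUnitaryGroup n ℂ)) (E : Set (PBond P k)) {r : ℝ}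
    (hr0 : 0 ≤ r) (hr4 : r ≤ 1 / 4) (hπ : (Fintype.card n : ℝ) * r < Real.pi)
    (hE : ∀ c ∈ E, ‖((GaugeField.gaugeAct g V c : Matrix.specialUnitaryGroup n ℂ) : Matrix n n ℂ) - 1‖ ≤ r) :
    ∃ A : PBond P k → Matrix n n ℂ, ∃ hA : ∀ c, A c ∈ lieSU n,
      (∀ c, ‖A c‖ ≤ 2 * r) ∧ (∀ c ∈ E, dataSU k A hA c = GaugeField.gaugeAct g V c) ∧ (∀ c ∉ E, A c = 0) := by
  -- bondwise choice of the logarithm on `E`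
  have hlog : ∀ c : PBond P k, c ∈ E → ∃ X : Matrix n n ℂ, ∃ hX : X ∈ lieSU n, ‖X‖ ≤ 2 * r ∧ expSU ⟨X, hX⟩ = GaugeField.gaugeAct g V c :=
    fun c hc => exists_lieSU_log_of_norm_sub_one_le (GaugeField.gaugeAct g V c) (hE c hc) hr4 hπ
  choose X hX hXn hXe using hlog
  have hA : ∀ c, (fun c : PBond P k => if hc : c ∈ E then X c hc else 0) c ∈ lieSU n := fun c => by
    by_cases hc : c ∈ E
    · simp only [hc, ↓reduceDIte]; exact hX c hc
    · simp only [hc, ↓reduceDIte]; exact Submodule.zero_mem _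
  refine ⟨fun c => if hc : c ∈ E then X c hc else 0, hA, fun c => ?_, fun c hc => ?_, fun c hc => ?_⟩
  · by_cases hc : c ∈ E
    · simp only [hc, ↓reduceDIte]; exact hXn c hc
    · simp only [hc, ↓reduceDIte, norm_zero]; linarith
  · -- on `E` the datum re-exponentiates the frame logarithm
    apply Subtype.ext
    have e1 : ((dataSU k (fun c : PBond P k => if hc : c ∈ E then X c hc else 0) hA c : Matrix.specialUnitaryGroup n ℂ) : Matrix n n ℂ) = exp (X c hc) := by
      rw [coe_dataSU]; simp only [hc, ↓reduceDIte]
    have e2 := congrArg (fun W : Matrix.specialUnitaryGroup n ℂ => (W : Matrix n n ℂ)) (hXe c hc)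
    simp only [coe_expSU] at e2
    rw [e1]; exact e2
  · simp only [hc, ↓reduceDIte]

end Log

/-! ## §5 Summary: the framed START exists -/

section Summary

variable {P : Params} {n : Type*} [Fintype n] [DecidableEq n] [Nonempty n]
variable (k : ℕ) (hk : k ≤ P.m + P.K)

include hk in
/-- ★★★ **THE FRAMED CANDIDATE EXISTS, AT EVERY ODD `L > 1`**: let the coarse frame `g` flatten the datum `V` to `‖V^{g}(c) − 1‖ ≤ r` on a set `E` of level-`k` bonds (`0 ≤ r ≤ 1/4`,
`|n|·r < π`), and let `M := 2r` satisfy the `k`-free rows of the flat-frame START (`4C_S M ≤ 1`, `M ≤ 1`, R1-allL's three guards).  Then there is a finest `SU(n)` field `U₀` — the framed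
candidate `(cand k A)^{ĝ⁻¹}` of the zero-extended frame logarithm — with (i) EVERY finest plaquette within `(4·18^d·M + 16(C_S M)²)/(L^k)²` of `1` (dilute, `B` absolute), (ii) the
multiplicative `k`-fold defect `‖Ū₀^{(k)}(c)·V(c)* − 1‖ ≤ (K₁+3)·M²` on EVERY `c ∈ E`, and (iii) bond variables within `2C_S·M/L^k` of `1` in the frame `ĝ = g ∘ iterBlockOf k`.  The local
START of the glued R9′ field, in the ORIGINAL gauge. [cite: Balaban1985Variational, Thm 1 (8) p.279, (4) p.278, (11)–(13) pp.279–280; Balaban1985Averaging, Prop. 4 (134)–(135) p.38, pp.24–25] -/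
theorem exists_framedCandidate_allL (g : GaugeTransf P k (Matrix.specialUnitaryGroup n ℂ)) (V : GaugeField P k (Matrix.specialUnitaryGroup n ℂ)) (E : Set (PBond P k)) {r : ℝ}
    (hr0 : 0 ≤ r) (hr4 : r ≤ 1 / 4) (hπ : (Fintype.card n : ℝ) * r < Real.pi)
    (hE : ∀ c ∈ E, ‖((GaugeField.gaugeAct g V c : Matrix.specialUnitaryGroup n ℂ) : Matrix n n ℂ) - 1‖ ≤ r)
    (hM4 : 4 * (CS P * (2 * r)) ≤ 1) (hM1' : 2 * r ≤ 1)
    (hm : (((P.d : ℝ) + 1) * ((18 : ℝ) ^ P.d * (2 + ((P.d : ℝ) + 1) * (18 : ℝ) ^ P.d)) * (324 * (((P.d + 2) * P.L : ℕ) : ℝ) ^ 2) / ((P.L : ℝ) * ((P.L : ℝ) - 1))) *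
      (2 * (((P.d : ℝ) + 1) * (CS P * (2 * r)))) ≤ 1)
    (h32 : 32 * (((P.d + 2) * P.L : ℕ) : ℝ) * (2 * (((P.d : ℝ) + 1) * (CS P * (2 * r)))) ≤ 1)
    (hN : 4 * (((P.d + 2) * P.L : ℕ) : ℝ) * (2 * (((P.d : ℝ) + 1) * (CS P * (2 * r)))) < deltaSU n) :
    ∃ U₀ : GaugeField P 0 (Matrix.specialUnitaryGroup n ℂ),
      (∀ q : Plaq P 0, GaugeGroup.dist1 (GaugeField.plaqHol U₀ q) ≤ 4 * (18 : ℝ) ^ P.d * (2 * r) / ((P.L : ℝ) ^ k) ^ 2 + 16 * (CS P * (2 * r) / (P.L : ℝ) ^ k) ^ 2) ∧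
      (∀ c ∈ E, ‖((Averaging.iter (fun i => blockAvg (P := P) (j := i) (expMeanLogSU (n := n))) k U₀ c : Matrix.specialUnitaryGroup n ℂ) : Matrix n n ℂ) *
            star ((V c : Matrix.specialUnitaryGroup n ℂ) : Matrix n n ℂ) - 1‖ ≤
          (((((P.d : ℝ) + 1) * ((18 : ℝ) ^ P.d * (2 + ((P.d : ℝ) + 1) * (18 : ℝ) ^ P.d)) * (324 * (((P.d + 2) * P.L : ℕ) : ℝ) ^ 2) / ((P.L : ℝ) * ((P.L : ℝ) - 1))) *
                (2 * (((P.d : ℝ) + 1) * CS P)) ^ 2 + ((P.d : ℝ) + 1) * CS P ^ 2) + 3) * (2 * r) ^ 2) ∧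
      (∀ b : PBond P 0, ‖((GaugeField.gaugeAct (fun x : Site P 0 => g (iterBlockOf k x)) U₀ b : Matrix.specialUnitaryGroup n ℂ) : Matrix n n ℂ) - 1‖ ≤
          2 * (CS P * (2 * r) / (P.L : ℝ) ^ k)) := by
  obtain ⟨A, hA, hAn, hAE, -⟩ := exists_frameLog g V E hr0 hr4 hπ hE
  have hM1 : CS P * (2 * r) ≤ 1 := by
    have : 0 ≤ CS P * (2 * r) := mul_nonneg (CS_nonneg P) (by linarith)
    linarith
  refine ⟨framed k g (cand k A hA), fun q => dist1_plaqHol_framedCand_le k hk g A hA hAn hM4 q, fun c hc => ?_,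
    fun b => norm_coe_frame_framedCand_sub_one_le k hk g A hA hAn hM1 b⟩
  exact norm_iter_framedCand_mul_star_sub_one_le_allL k hk g V A hA hAn hM1 hM1' hm h32 hN c (hAE c hc).symm

end Summary

end Summit.QuantumFields.YangMills.Theorems.FramedCandidate

end
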